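import Literature.NumberTheory.EllipticCurves.IwasawaAlgebraProofs
import Mathlib.RingTheory.Ideal.GoingUp
import Mathlib.RingTheory.KrullDimension.Regular
import Mathlib.RingTheory.PowerSeries.Inverse
import HarnessLib

/-!
# Pseudo-null `A⟦X⟧`-modules that are finite over `A` are `A`-torsion (`dim A = 2`)
# (helper file 2 of the Λ₂ → Λ descent lemma for crux 2 `GoodLatticeBDPValue`, stmt-BirchSwinnertonDyer-19032, cell `bsd-eis` seat `bsd-eis-k5-c2`)

Generic commutative algebra for the descent from the two-variable Iwasawa algebra
`Λ₂ = A⟦X⟧`, `A = ℤ_p⟦S⟧`, to `Λ = ℤ_p⟦T⟧` (ky MEMO-1 R2 (v); k5-ty SPEC §1 row «descent (v)»).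

MAIN RESULT (`isTorsion_of_isPseudoNull`).  Let `A` be a Noetherian local domain of Krull dimension
`2` and `M` an `A⟦X⟧`-module which is finitely generated over `A` (compatible structures) and
PSEUDO-NULL over `A⟦X⟧` (`M_𝔓 = 0` for every prime `𝔓` of height `≤ 1`).  Then `M` is `A`-torsion.
Proof: if `c ∈ M` had zero `A`-annihilator, `A` would embed into the module-finite, hence integral,
`A`-algebra `A' = A⟦X⟧/Ann(c) ↪ M`; lifting a chain of primes `𝔮₀ < 𝔮₁ < 𝔮₂` of `A` (length
`2 = dim A`) to `A'` by lying-over and going-up and pulling back to `A⟦X⟧` gives primes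
`𝔓₀ < 𝔓₁ < 𝔓₂ ⊇ Ann(c)`, so `ht 𝔓₀ + 2 ≤ dim A⟦X⟧ = dim A + 1 = 3`, i.e. `ht 𝔓₀ ≤ 1`, and
pseudo-nullity forces `M_{𝔓₀} = 0`, contradicting `Ann(c) ⊆ 𝔓₀`.  In the descent this is applied to
the cokernel of the embedding of the two-variable Selmer dual into its elementary module (which is
finite free over `A = ℤ_p⟦S⟧` by Weierstrass preparation, `EisensteinPrimesTwoVariableWeierstrass`).
Also: `ringKrullDim_powerSeries_succ` (`dim A⟦X⟧ = dim A + 1` for a Noetherian local domain `A`,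
Mathlib's `dim R/(x) + 1 = dim R` at `x = X`) and `ringKrullDim_lambda₂` (`dim ℤ_p⟦S⟧⟦T⟧ = 3`).

HONEST FRAMING: generic algebra; closes nothing by itself. What is NOT here: the descent theorem
(`EisensteinPrimesTwoVariableDescent.lean`), Weierstrass finiteness (file 1), any Galois theory.

References: Bourbaki, *Algèbre commutative* VII §4.4 (pseudo-null modules), VIII §3 (dimension of
power series rings); Matsumura, *Commutative Ring Theory*, Thm. 9.4 (lying over / going up),
Thm. 15.4; Neukirch–Schmidt–Wingberg (2008) V §1.
-/

-- the summit namespace `Summit.BirchSwinnertonDyer.BirchSwinnertonDyer` repeats the problem name by design (D-0017)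
set_option linter.dupNamespace false
set_option autoImplicit false

noncomputable section

open PowerSeries IsLocalRing Literature.NumberTheory.EllipticCurves

namespace Summit.BirchSwinnertonDyer.BirchSwinnertonDyer.Theorems.IwasawaTwoVariable

/-! ## §1 `dim A⟦X⟧ = dim A + 1` -/

section Dimension

variable (A : Type*) [CommRing A]

/-- `A⟦X⟧ ⧸ (X) ≃+* A` via the constant coefficient (any commutative ring). [folklore] -/
theorem nonempty_quotient_span_X_ringEquiv :
    Nonempty ((PowerSeries A ⧸ Ideal.span {(X : PowerSeries A)}) ≃+* A) :=
  ⟨(Ideal.quotEquivOfEq (by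
      ext f
      rw [RingHom.mem_ker, Ideal.mem_span_singleton, PowerSeries.X_dvd_iff])).trans
    (RingHom.quotientKerEquivOfSurjective (PowerSeries.constantCoeff_surj (R := A)))⟩

/-- **`dim A⟦X⟧ = dim A + 1`** for a Noetherian local domain `A` (Mathlib: `dim R/(x) + 1 = dim R`
for a non-zero-divisor `x` in the maximal ideal of a Noetherian local ring, at `R = A⟦X⟧`, `x = X`,
`A⟦X⟧/(X) ≅ A`; Matsumura Thm. 15.4). [folklore] -/
theorem ringKrullDim_powerSeries_succ [IsDomain A] [IsNoetherianRing A] [IsLocalRing A] :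
    ringKrullDim (PowerSeries A) = ringKrullDim A + 1 := by
  have hX : (X : PowerSeries A) ∈ maximalIdeal (PowerSeries A) := by
    rw [mem_maximalIdeal, mem_nonunits_iff, PowerSeries.isUnit_iff_constantCoeff]
    simp
  have h := ringKrullDim_quotient_span_singleton_succ_eq_ringKrullDim_of_mem_nonZeroDivisors
    (mem_nonZeroDivisors_of_ne_zero (PowerSeries.X_ne_zero (R := A))) hX
  obtain ⟨e⟩ := nonempty_quotient_span_X_ringEquiv A
  rw [ringKrullDim_eq_of_ringEquiv e] at h
  exact h.symm

/-- `dim ℤ_p⟦S⟧⟦T⟧ = 3` (the two-variable Iwasawa algebra `Λ₂` is a `3`-dimensional regular local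
ring; Bourbaki AC VIII §3). [folklore] -/
theorem ringKrullDim_lambda₂ (p : ℕ) [Fact p.Prime] :
    ringKrullDim (PowerSeries (IwasawaAlgebra p)) = 3 := by
  rw [ringKrullDim_powerSeries_succ, IwasawaAlgebra.ringKrullDim_eq_two]
  rfl

end Dimension

/-! ## §2 Pseudo-null and finite over `A` ⟹ `A`-torsion -/

section Torsion

variable {A : Type*} [CommRing A] [IsDomain A] [IsNoetherianRing A] [IsLocalRing A]
variable {M : Type*} [AddCommGroup M] [Module (PowerSeries A) M] [Module A M]
  [IsScalarTower A (PowerSeries A) M]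

/-- Height bookkeeping: primes `𝔓₀ < 𝔓₁ < 𝔓₂` in a ring of Krull dimension `≤ 3` force
`ht 𝔓₀ ≤ 1`. [folklore] -/
theorem height_le_one_of_lt_of_lt {R : Type*} [CommRing R] (hR : ringKrullDim R ≤ 3)
    {P₀ P₁ P₂ : Ideal R} [P₀.IsPrime] [P₁.IsPrime] [P₂.IsPrime] (h₀₁ : P₀ < P₁) (h₁₂ : P₁ < P₂) :
    P₀.height ≤ 1 := by
  have h1 := Ideal.height_add_one_le_of_lt_of_isPrime h₀₁
  have h2 := Ideal.height_add_one_le_of_lt_of_isPrime h₁₂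
  have h3 : ((P₂.height : WithBot ℕ∞)) ≤ 3 := Ideal.height_le_ringKrullDim_of_isPrime.trans hR
  have h3' : P₂.height ≤ 3 := by
    rw [show (3 : WithBot ℕ∞) = ((3 : ℕ∞) : WithBot ℕ∞) from rfl] at h3
    exact WithBot.coe_le_coe.1 h3
  have e3 : (3 : ℕ∞) = 1 + 1 + 1 := by norm_num
  have h4 : P₀.height + 1 + 1 ≤ 1 + 1 + 1 :=
    ((add_le_add h1 (le_refl (1 : ℕ∞))).trans h2).trans (h3'.trans e3.le)
  exact (WithTop.add_le_add_iff_right WithTop.one_ne_top).1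
    ((WithTop.add_le_add_iff_right WithTop.one_ne_top).1 h4)

/-- **A pseudo-null `A⟦X⟧`-module which is finitely generated over `A` is `A`-torsion**, for `A` a
Noetherian local domain of Krull dimension `2` (e.g. `A = ℤ_p⟦S⟧`, `A⟦X⟧ = Λ₂`).  Proof by
lying-over / going-up along the module-finite algebra `A → A⟦X⟧/Ann(c)` and the count
`ht + 2 ≤ dim A⟦X⟧ = 3` (module docstring).  (Bourbaki AC VII §4.4: pseudo-null = support in
codimension `≥ 2`.) [folklore] -/
theorem isTorsion_of_isPseudoNull (hA : ringKrullDim A = 2) [Module.Finite A M]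
    (hM : Module.IsPseudoNull (PowerSeries A) M) : Module.IsTorsion A M := by
  intro c
  by_contra! H
  -- the annihilator of `c` and the cyclic algebra `A' = A⟦X⟧ / Ann(c)`
  set 𝔞 : Ideal (PowerSeries A) := Ideal.torsionOf (PowerSeries A) M c with h𝔞
  haveI : IsNoetherian A M := isNoetherian_of_isNoetherianRing_of_finite A M
  -- `A' ↪ M`, so `A'` is module-finite over `A`
  let ι : (PowerSeries A ⧸ 𝔞) →ₗ[PowerSeries A] M :=
    (Submodule.subtype _).comp (Ideal.quotTorsionOfEquivSpanSingleton (PowerSeries A) M c).toLinearMap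
  have hι : Function.Injective ι :=
    (Submodule.injective_subtype _).comp (LinearEquiv.injective _)
  haveI hfin : Module.Finite A (PowerSeries A ⧸ 𝔞) :=
    Module.Finite.of_injective (ι.restrictScalars A) hι
  haveI : Algebra.IsIntegral A (PowerSeries A ⧸ 𝔞) := Algebra.IsIntegral.of_finite A _
  -- `A → A'` is injective because `c` has no `A`-torsion
  have hker : RingHom.ker (algebraMap A (PowerSeries A ⧸ 𝔞)) = ⊥ := by
    refine le_bot_iff.1 fun a ha => ?_
    rw [RingHom.mem_ker, IsScalarTower.algebraMap_apply A (PowerSeries A) (PowerSeries A ⧸ 𝔞),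
      Ideal.Quotient.algebraMap_eq, Ideal.Quotient.eq_zero_iff_mem, h𝔞, Ideal.mem_torsionOf_iff,
      algebraMap_smul] at ha
    by_contra ha0
    exact H ⟨a, mem_nonZeroDivisors_of_ne_zero ha0⟩ ha
  -- a chain of primes of length `2` in `A`
  obtain ⟨l, hl⟩ := Order.le_krullDim_iff.1 (le_of_eq hA.symm : ((2 : ℕ) : WithBot ℕ∞) ≤ ringKrullDim A)
  have h0 : (0 : ℕ) < l.length + 1 := by omega
  have h1 : (1 : ℕ) < l.length + 1 := by omega
  have h2 : (2 : ℕ) < l.length + 1 := by omega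
  set q₀ : PrimeSpectrum A := l ⟨0, h0⟩
  set q₁ : PrimeSpectrum A := l ⟨1, h1⟩
  set q₂ : PrimeSpectrum A := l ⟨2, h2⟩
  have hq₀₁ : q₀ < q₁ := l.strictMono (Fin.mk_lt_mk.2 (by norm_num))
  have hq₁₂ : q₁ < q₂ := l.strictMono (Fin.mk_lt_mk.2 (by norm_num))
  -- lying over `q₀`, going up to `q₁`, `q₂`
  obtain ⟨Q₀, -, hQ₀, hQ₀c⟩ := Ideal.exists_ideal_over_prime_of_isIntegral q₀.asIdeal
    (⊥ : Ideal (PowerSeries A ⧸ 𝔞)) (by rw [← RingHom.ker_eq_comap_bot, hker]; exact bot_le)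
  haveI := hQ₀
  obtain ⟨Q₁, hQ₀₁, hQ₁, hQ₁c⟩ := Ideal.exists_ideal_over_prime_of_isIntegral_of_isPrime
    q₁.asIdeal Q₀ (by rw [hQ₀c]; exact ((PrimeSpectrum.asIdeal_lt_asIdeal _ _).2 hq₀₁).le)
  haveI := hQ₁
  obtain ⟨Q₂, hQ₁₂, hQ₂, hQ₂c⟩ := Ideal.exists_ideal_over_prime_of_isIntegral_of_isPrime
    q₂.asIdeal Q₁ (by rw [hQ₁c]; exact ((PrimeSpectrum.asIdeal_lt_asIdeal _ _).2 hq₁₂).le)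
  haveI := hQ₂
  have hQ₀₁' : Q₀ < Q₁ := by
    refine lt_of_le_of_ne hQ₀₁ fun h => (ne_of_lt ((PrimeSpectrum.asIdeal_lt_asIdeal _ _).2 hq₀₁)) ?_
    rw [← hQ₀c, ← hQ₁c, h]
  have hQ₁₂' : Q₁ < Q₂ := by
    refine lt_of_le_of_ne hQ₁₂ fun h => (ne_of_lt ((PrimeSpectrum.asIdeal_lt_asIdeal _ _).2 hq₁₂)) ?_
    rw [← hQ₁c, ← hQ₂c, h]
  -- pull the chain back to `A⟦X⟧`: primes `P₀ < P₁ < P₂` containing `Ann(c)`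
  set P₀ : Ideal (PowerSeries A) := Q₀.comap (Ideal.Quotient.mk 𝔞) with hP₀
  set P₁ : Ideal (PowerSeries A) := Q₁.comap (Ideal.Quotient.mk 𝔞) with hP₁
  set P₂ : Ideal (PowerSeries A) := Q₂.comap (Ideal.Quotient.mk 𝔞) with hP₂
  have hinj := Ideal.comap_injective_of_surjective (Ideal.Quotient.mk 𝔞) Ideal.Quotient.mk_surjective
  have hP₀₁ : P₀ < P₁ :=
    lt_of_le_of_ne (Ideal.comap_mono hQ₀₁) fun h => (ne_of_lt hQ₀₁') (hinj h)
  have hP₁₂ : P₁ < P₂ :=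
    lt_of_le_of_ne (Ideal.comap_mono hQ₁₂) fun h => (ne_of_lt hQ₁₂') (hinj h)
  have hdim : ringKrullDim (PowerSeries A) ≤ 3 := by
    rw [ringKrullDim_powerSeries_succ, hA]
    exact le_of_eq rfl
  have hht : P₀.height ≤ 1 := height_le_one_of_lt_of_lt hdim hP₀₁ hP₁₂
  -- pseudo-nullity at `P₀` kills `c`, but `Ann(c) ⊆ P₀`
  have hsub : Subsingleton (LocalizedModule (Ideal.primeCompl P₀) M) := hM ⟨P₀, inferInstance⟩ hht
  have hz : (LocalizedModule.mk c 1 : LocalizedModule (Ideal.primeCompl P₀) M) =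
      LocalizedModule.mk 0 1 :=
    Subsingleton.elim _ _
  rw [LocalizedModule.mk_eq] at hz
  obtain ⟨u, hu⟩ := hz
  simp only [one_smul, smul_zero] at hu
  have hu' : (u : PowerSeries A) ∈ 𝔞 := (Ideal.mem_torsionOf_iff c _).2 hu
  have h𝔞P : 𝔞 ≤ P₀ := fun x hx => by
    rw [hP₀, Ideal.mem_comap, Ideal.Quotient.eq_zero_iff_mem.2 hx]
    exact Q₀.zero_mem
  exact u.2 (h𝔞P hu')

end Torsion


/-! ## §3 (I2) bookkeeping: a pseudo-isomorphism out of a module without pseudo-null submodules is injective -/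

section NoPseudoNull

variable {R : Type*} [CommRing R] {M N : Type*} [AddCommGroup M] [Module R M]
  [AddCommGroup N] [Module R N]

/-- If `M` has no non-zero pseudo-null submodule (hypothesis (I2) of the cell's road: Greenberg 1978 /
Perrin-Riou 1984 / Rubin 1991 Thm. 5.3 (v) for the two-variable Selmer dual) then every
pseudo-isomorphism `M → N` (pseudo-null kernel and cokernel, e.g. the structure-theorem map to an
elementary module) is injective. [folklore] -/
theorem injective_of_isPseudoIsomorphism (f : M →ₗ[R] N) (hf : f.IsPseudoIsomorphism)
    (hI2 : ∀ P : Submodule R M, Module.IsPseudoNull R P → P = ⊥) : Function.Injective f := by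
  rw [← LinearMap.ker_eq_bot]
  exact hI2 _ hf.1

/-- The cokernel of a pseudo-isomorphism is pseudo-null (definition unfolding). [folklore] -/
theorem isPseudoNull_coker_of_isPseudoIsomorphism (f : M →ₗ[R] N) (hf : f.IsPseudoIsomorphism) :
    Module.IsPseudoNull R (N ⧸ LinearMap.range f) :=
  hf.2

end NoPseudoNull

end Summit.BirchSwinnertonDyer.BirchSwinnertonDyer.Theorems.IwasawaTwoVariable

end
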